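import Summits.BirchSwinnertonDyer.BirchSwinnertonDyer.Theorems.TwoAdicConverseLambdaHalfTwistRankDoorTorsion
import Literature.NumberTheory.EllipticCurves.RationalPointInfiniteOrderCriteria
import Summits.BirchSwinnertonDyer.Rank1Residual.X10.CMPartnerMinimality
import Literature.NumberTheory.EllipticCurves.BSDInvariantsProofs
import HarnessLib

/-!
# Route `TwoAdicConverse` (rung S3), crux `OrdLambdaHalfAtTwo` (item 19556) AT THE CURVE `45a1` — an «LH» row on the REDUCIBLE habitat:
# the `λ`-half at a NON-census curve with a rational 2-torsion point, from PRINT {modularity} and three certificates, the twist-rank one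
# (ONE point of infinite order on `E^{(2)}`) DISCHARGED IN THE KERNEL

Cell `bsd-2adic` (run/shared/lean/pub/bsd-2adic/), seat `bsd-2adic-conv-1` (GEN 9). THEOREMS ONLY — no definition, no named fact, no axiom,
no `sorry`. HONEST FRAMING: per-curve predicate of item 19556 at ONE curve modulo displayed binders; closes no item; books nothing («LH» is
unpriced); BSD is not proved by any of this. PARTITION (D-0054): none — RANK axis (S3); NOT a census class; types-the-object-of.

THE ROW. `W = 45a1` = `[1,-1,0,0,-5]` (Cremona's minimal model; `N = 45 = 3²·5`, rank `0`, `#E(ℚ)_tors = 2` (one rational point of order 2), `(2/N) = −1`; good ordinary at `2`).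
Analytic side (CERT, two engines msfromell j270470 / ENGINE-2 j273542): `λ_an = 1`, the zero of `L₂(E,T)` at `T = −2` (law L2:
`w(E)·(2/N) = −1`). Algebraic side: the twist `E^{(2)}` (minimal model `M = [0,0,0,-12,-2576]`, conductor `64·N`) has a rational
point of infinite order — PROVED HERE by the tree's NL checker `one_le_mordellWeilRank_of_dvd_den` (Lutz–Nagell on the minimal model: the point
`3·(20,72) = (1171700/1849, 1268282376/79507)` has `43 ∣ den(x)`), transported to the door's model `W.quadraticTwist 2 = ⟨2,-2,0,0⟩ • M`.
DOOR: `lambdaHalfAtTwo_of_natCard_selmerGroup_two_eq_torsion_of_analyticLambdaEq_le_twistRank` (this GEN): corank `0` from the 2-descent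
certificate `#Sel₂(E/ℚ) = #E(ℚ)[2]` (fact-free), `X` torsion by Mazur's Thm 1.4, `λ(L₀) = 1 ≤ rank E^{(2)} ≤ λ(X)`.
DISPLAYED BINDERS: PRINT `hmod`; CERT `hper₀`, `hlan : AnalyticLambdaEq W 2 1`, `hSel : #Sel₂(E/ℚ) = #E(ℚ)[2]` (mwrank, kit j273941).
NOTHING ELSE — in particular neither Kato (`h17`) nor Matsuno 6.4 (`h64`), which GEN 8's parity door needed on this locus.

References: J. H. Silverman, GTM 106 (2009), VII.3.4, VIII.6.7, X.4.2, X.5.4 [SilvermanAEC2009]; A. Kraus, Manuscripta Math. 65 (1989)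
[Kraus1989]; R. Greenberg, LNM 1716 (1999), Thm. 1.4, Thm. 1.9 [GreenbergLNM1716]; J. E. Cremona, *Algorithms* (1997), Table 1 [Cremona2006].
-/

set_option linter.dupNamespace false
set_option autoImplicit false

noncomputable section

open scoped Classical
open scoped AddSubgroup
open CongruenceSubgroup WeierstrassCurve Literature.NumberTheory.EllipticCurves Literature.NumberTheory.EllipticCurves.ModularForms
  Literature.NumberTheory.EllipticCurves.Rank1Residual
  Summit.BirchSwinnertonDyer.Rank1Residual.X1.MuLambda
  Summit.BirchSwinnertonDyer.Rank1Residual.X1.ParitySqueeze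
  Summit.BirchSwinnertonDyer.BirchSwinnertonDyer.Theorems.Rank1ResidualX1Defs
  Summit.BirchSwinnertonDyer.Rank1Residual.X5 Summit.BirchSwinnertonDyer.Rank1Residual.X5.O1
  Summit.BirchSwinnertonDyer.BirchSwinnertonDyer.Rank1Residual.IntModel
  Summit.BirchSwinnertonDyer.Rank1Residual.Supersingular

namespace Summit.BirchSwinnertonDyer.BirchSwinnertonDyer.Theorems.TwoAdicTwistConverse

/-! ## §1 The twist `E^{(2)}`: minimal model, minimality, a point of infinite order -/

/-- `M = [0,0,0,-12,-2576]` (Cremona's minimal model of `45a1^{(2)}`) is an elliptic curve. [cite: Cremona2006, Table 1] -/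
theorem isElliptic_twistTwo_45a1 : (⟨0, 0, 0, -12, -2576⟩ : WeierstrassCurve ℚ).IsElliptic :=
  Summit.BirchSwinnertonDyer.Rank1Residual.X11b.isElliptic_of_discOf_ne_zero (0) (0) (0) (-12) (-2576) (by decide +kernel)

/-- `M` is globally minimal (Kraus' criterion, decided). [cite: Kraus1989, Prop. 1 and Prop. 2] -/
theorem isGloballyMinimal_twistTwo_45a1 : (⟨0, 0, 0, -12, -2576⟩ : WeierstrassCurve ℚ).IsGloballyMinimal :=
  Summit.BirchSwinnertonDyer.Rank1Residual.X10.isGloballyMinimal_of_krausCriterion_bounded₃ (0) (0) (0) (-12) (-2576)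
    (by decide +kernel) (by decide +kernel) (by decide +kernel) (by decide +kernel)

/-- **`1 ≤ rank 45a1^{(2)}(ℚ)` IN THE KERNEL** — NL certificate: the rational point `(1171700/1849, 1268282376/79507)` of the globally minimal model
`M` has `43 ∣ den(x)`, hence infinite order (Lutz–Nagell; tree checker `one_le_mordellWeilRank_of_dvd_den`). [cite: SilvermanAEC2009, VII.3.4 and Thm. VIII.6.7] -/
theorem one_le_mordellWeilRank_twistTwo_45a1 : 1 ≤ (⟨0, 0, 0, -12, -2576⟩ : WeierstrassCurve ℚ).mordellWeilRank := by
  haveI := isElliptic_twistTwo_45a1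
  haveI := isGloballyMinimal_twistTwo_45a1
  haveI : Fact (Nat.Prime 43) := ⟨by norm_num⟩
  have hT : (⟨0, 0, 0, -12, -2576⟩ : WeierstrassCurve ℚ).toAffine.Nonsingular ((1171700 : ℚ) / 1849) ((1268282376 : ℚ) / 79507) :=
    WeierstrassCurve.Affine.equation_iff_nonsingular.mp ((WeierstrassCurve.Affine.equation_iff _ _).mpr (by norm_num))
  exact one_le_mordellWeilRank_of_dvd_den _ 43 (by norm_num) hT (by decide +kernel)

/-! ## §2 `45a1`, the door's model of the twist, rank transport -/

/-- `45a1` = `[1,-1,0,0,-5]` is an elliptic curve. [cite: Cremona2006, Table 1] -/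
theorem isElliptic_45a1 : (⟨1, -1, 0, 0, -5⟩ : WeierstrassCurve ℚ).IsElliptic :=
  Summit.BirchSwinnertonDyer.Rank1Residual.X11b.isElliptic_of_discOf_ne_zero (1) (-1) (0) (0) (-5) (by decide +kernel)

/-- `45a1` is globally minimal (Kraus' criterion, decided). [cite: Kraus1989, Prop. 1 and Prop. 2] -/
theorem isGloballyMinimal_45a1 : (⟨1, -1, 0, 0, -5⟩ : WeierstrassCurve ℚ).IsGloballyMinimal :=
  Summit.BirchSwinnertonDyer.Rank1Residual.X10.isGloballyMinimal_of_krausCriterion_bounded₃ (1) (-1) (0) (0) (-5)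
    (by decide +kernel) (by decide +kernel) (by decide +kernel) (by decide +kernel)

/-- `W.quadraticTwist 2 = ⟨0, b₂/2, 0, 2b₄, 2b₆⟩ = ⟨2,-2,0,0⟩ • M` (Silverman III.1 formulas, `norm_num`). [cite: SilvermanAEC2009, III.1 Table 3.1] -/
theorem quadraticTwist_two_eq_smul_45a1 :
    (⟨1, -1, 0, 0, -5⟩ : WeierstrassCurve ℚ).quadraticTwist 2 = (⟨Units.mk0 (2 : ℚ) (by norm_num), -2, 0, 0⟩ : VariableChange ℚ) • (⟨0, 0, 0, -12, -2576⟩ : WeierstrassCurve ℚ) := by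
  ext <;> simp only [quadraticTwist_a₁, quadraticTwist_a₂, quadraticTwist_a₃, quadraticTwist_a₄, quadraticTwist_a₆,
    WeierstrassCurve.b₂, WeierstrassCurve.b₄, WeierstrassCurve.b₆, variableChange_a₁, variableChange_a₂, variableChange_a₃,
    variableChange_a₄, variableChange_a₆, Units.val_inv_eq_inv_val, Units.val_mk0] <;> norm_num

/-- **`1 ≤ rank 45a1^{(2)}(ℚ)` on the door's model** (`mordellWeilRank_variableChange_holds`). [cite: SilvermanAEC2009, III.3.1(b) and VIII.6] -/
theorem one_le_mordellWeilRank_quadraticTwist_two_45a1 : 1 ≤ ((⟨1, -1, 0, 0, -5⟩ : WeierstrassCurve ℚ).quadraticTwist 2).mordellWeilRank := by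
  rw [quadraticTwist_two_eq_smul_45a1]
  haveI := isElliptic_twistTwo_45a1
  have h := mordellWeilRank_variableChange_holds (⟨0, 0, 0, -12, -2576⟩ : WeierstrassCurve ℚ) (⟨Units.mk0 (2 : ℚ) (by norm_num), -2, 0, 0⟩ : VariableChange ℚ)
  unfold mordellWeilRank_variableChange at h
  rw [h]
  exact one_le_mordellWeilRank_twistTwo_45a1

/-! ## §3 The row -/

/-- **Item 19556's predicate at `45a1`**: `LambdaHalfAtTwo W`, `W = [1,-1,0,0,-5]`, from PRINT {`hmod`} + CERT {`hper₀`, `hlan : λ_an = 1`,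
`hSel : #Sel₂(E/ℚ) = #E(ℚ)[2]`}; the twist-rank input is §2's kernel theorem, «`X` torsion» is Mazur's Thm 1.4. Not a census class; books nothing.
[cite: GreenbergLNM1716, Thm. 1.4 (p. 60) and Thm. 1.9 (p. 63)] [cite: DokchitserDokchitserAnnals2010, Lemma 4.14] [cite: SilvermanAEC2009, Thm X.4.2] -/
theorem lambdaHalfAtTwo_45a1 [(⟨1, -1, 0, 0, -5⟩ : WeierstrassCurve ℚ).IsElliptic] [(⟨1, -1, 0, 0, -5⟩ : WeierstrassCurve ℚ).IsGloballyMinimal]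
    (hmod : nonempty_modularParametrizationData)
    (hper₀ : ∀ [NeZero ((⟨1, -1, 0, 0, -5⟩ : WeierstrassCurve ℚ).conductorNorm ℤ)] (f : CuspForm (Gamma0 ((⟨1, -1, 0, 0, -5⟩ : WeierstrassCurve ℚ).conductorNorm ℤ)) 2),
      IsNewformOf (⟨1, -1, 0, 0, -5⟩ : WeierstrassCurve ℚ) f → ∀ ϖ : ℚ, (ϖ : ℝ) * (⟨1, -1, 0, 0, -5⟩ : WeierstrassCurve ℚ).realPeriodRat = plusPeriod f → 0 ≤ padicValRat 2 ϖ)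
    (hSel : Nat.card ((⟨1, -1, 0, 0, -5⟩ : WeierstrassCurve ℚ).selmerGroup 2) = Nat.card ((⟨1, -1, 0, 0, -5⟩ : WeierstrassCurve ℚ).toAffine.Point[((2 : ℕ) : ℤ)]))
    (hlan : AnalyticLambdaEq (⟨1, -1, 0, 0, -5⟩ : WeierstrassCurve ℚ) 2 1) :
    LambdaHalfAtTwo (⟨1, -1, 0, 0, -5⟩ : WeierstrassCurve ℚ) :=
  lambdaHalfAtTwo_of_natCard_selmerGroup_two_eq_torsion_of_analyticLambdaEq_le_twistRank _ hmod hper₀ hSel hlan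
    (le_trans (by norm_num) one_le_mordellWeilRank_quadraticTwist_two_45a1)

end Summit.BirchSwinnertonDyer.BirchSwinnertonDyer.Theorems.TwoAdicTwistConverse

end
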